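import Literature.NumberTheory.Transcendental.ZeroEstDimension
import Literature.NumberTheory.Transcendental.ZeroEstHilbert
import Literature.NumberTheory.Transcendental.PhilipponZeroEstimateChain
import Literature.AlgebraicGeometry.Resolution.CohenMacaulayCatenary
import HarnessLib

/-!
# Zero estimates on commutative algebraic groups, IX: the generic complete intersection (Prop. 2.2)

Topic `Literature/NumberTheory/Transcendental`. Ninth module of the discharge of
`Literature.NumberTheory.Transcendental.philippon1986_std` through D. Roy's exposition of
Philippon's zero estimate (Nesterenko–Philippon (eds.), LNM 1752, Ch. 11) for an abstract analytic
group model `M : AnalyticGroupModel V N`. This is Roy's Prop. 2.2 (Philippon's Prop. 3.3) in the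
lossy form used for the zero estimate, transplanted from the tree's `𝔾ₐ × 𝔾ₘⁿ` version
(`PhilipponZeroEstimateChain.lean`, `PhilipponZeroEstimateRegular.lean`) to the cone over `Ḡ`:
the ambient ideal is `𝔊 = 𝔍(G)` instead of `(0)`, so that

* the dimension count for the **generic sequence** `Q₁, …, Q_r ∈ span S` (each `Q_{l+1}` outside
  the minimal primes `𝔭' ⊆ 𝔭ᵢ` of `𝔊 + (Q₁, …, Q_l)`, `exists_list_avoids`) runs in the affine
  domain `ℂ[X] ⧸ 𝔊` of dimension `n + 1` (Krull's height theorem and the dimension formula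
  `Literature.RingTheory.KrullDimension.ringKrullDim_quotient_add_eq_of_height_eq`:
  `dim ℂ[X]/𝔭' ≥ n + 1 - l`, `ringKrullDim_quotient_ge_of_mem_minimalPrimes`);
* the **non-zero-divisor property** of `Q_{l+1}` modulo `loc 𝔭ᵢ (𝔊 + (Q₁,…,Q_l))`
  (`isNZDMod_loc_ofList`) comes from the Cohen–Macaulay property of the REGULAR local ring
  `ℂ[X]_{𝔭ᵢ} ⧸ 𝔊` (the Jacobian criterion of `ZeroEstDimension.lean`,
  `relIdeal_map_eq_span_and_isRegularLocalRing`, with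
  `Literature.AlgebraicGeometry.Resolution.exists_isRegular_length_eq_ringKrullDim` and
  `isRegular_of_forall_notMem_minimalPrimes`).

Main result (`exists_ideal_hilbC_le`): for finitely many relevant homogeneous primes `𝔭ᵢ ⊇ 𝔊`
and a finite set `S ⊆ ⋂ 𝔭ᵢ` of polynomials of degree `≤ δ` such that every prime `𝔭' ⊆ 𝔭ᵢ`
containing `S` and `𝔊` has `dim ℂ[X]/𝔭' ≤ n + 1 - r`, there is an ideal
`𝔍 ≤ loc 𝔭ᵢ (𝔊 + (S))` for all `i` with `H_𝔍(t) ≤ 2^{(n+1) r} δ^r C_G (t+1)^{n+1-r}`, where `H` is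
the cumulative Hilbert function of `ZeroEstHilbert.lean` and `C_G = M.hilbConst` bounds
`H_𝔊(t) ≤ C_G (t+1)^{n+1}` (`hilbC_relIdeal_le`, from the sandwich of the prime `𝔊`).

Everything is PROVED; no named facts.

## References

* Yu. V. Nesterenko, P. Philippon (eds.), *Introduction to Algebraic Independence Theory*,
  LNM 1752, Springer 2001, Ch. 11 (D. Roy), Prop. 2.2 and its proof. [NesterenkoPhilippon2001]
* P. Philippon, *Lemmes de zéros dans les groupes algébriques commutatifs*, Bull. Soc. Math.
  France 114 (1986), 355–383, Prop. 3.3. [Philippon1986]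
* H. Matsumura, *Commutative Ring Theory*, Thm. 17.4, 17.8 (Cohen–Macaulay), Thm. 5.6, 13.5. [Matsumura1987]
-/

noncomputable section

open MvPolynomial Module IsLocalRing RingTheory.Sequence
open Literature.AlgebraicGeometry.Resolution

namespace Literature.NumberTheory.Transcendental

namespace AnalyticGroupModel

variable {V : Type*} [NormedAddCommGroup V] [NormedSpace ℂ V] [CompleteSpace V] [FiniteDimensional ℂ V]
  {N : ℕ} (M : AnalyticGroupModel V N)

attribute [local instance] MvPolynomial.gradedAlgebra

/-! ### The Hilbert function of `𝔊` -/

/-- The sandwich of the prime `𝔊` (`dim ℂ[X]/𝔊 = n + 1`). [folklore] -/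
theorem exists_sandwich_relIdeal : ∃ ρ a γ : ℕ, 1 ≤ ρ ∧ ∀ t, a ≤ t →
    ρ * (t - a + (M.dim + 1)).choose (M.dim + 1) ≤ ZeroEst.hilbC (M.relIdeal.restrictScalars ℂ) t ∧
    ZeroEst.hilbC (M.relIdeal.restrictScalars ℂ) t ≤ ρ * (t + γ + (M.dim + 1)).choose (M.dim + 1) := by
  haveI := M.isPrime_relIdeal
  exact ZeroEst.exists_sandwich_of_isPrime M.ringKrullDim_quotient_relIdeal

/-- **The constant `C_G`** with `H_𝔊(t) ≤ C_G (t+1)^{n+1}` (depends only on the model).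
[cite: NesterenkoPhilippon2001, Ch. 11 §2.2 (85)] -/
def hilbConst : ℕ :=
  Classical.choose M.exists_sandwich_relIdeal *
    (Classical.choose (Classical.choose_spec M.exists_sandwich_relIdeal) +
      Classical.choose (Classical.choose_spec (Classical.choose_spec M.exists_sandwich_relIdeal)) +
        (M.dim + 1) + 1) ^ (M.dim + 1)

/-- `H_𝔊(t) ≤ C_G (t+1)^{n+1}`. [cite: NesterenkoPhilippon2001, Ch. 11 §2.2 (85)] -/
theorem hilbC_relIdeal_le (t : ℕ) :
    ZeroEst.hilbC (M.relIdeal.restrictScalars ℂ) t ≤ M.hilbConst * (t + 1) ^ (M.dim + 1) := by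
  have h := Classical.choose_spec (Classical.choose_spec (Classical.choose_spec M.exists_sandwich_relIdeal))
  exact ZeroEst.hilbC_le_mul_pow_of_sandwich (fun t ht => (h.2 t ht).2) t

/-! ### Dimension of the minimal primes over `𝔊 + (Q₁, …, Q_l)` -/

/-- **Krull's height theorem in `ℂ[X] ⧸ 𝔊`**: a minimal prime `𝔭'` of `𝔊 + (S)`, `S` finite, has
`dim ℂ[X]/𝔭' ≥ n + 1 - #S`. [cite: Matsumura1987, Thm. 13.5, Thm. 5.6] -/
theorem ringKrullDim_quotient_ge_of_mem_minimalPrimes {𝔭' : Ideal (MvPolynomial (Fin (N + 1)) ℂ)}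
    {S : Finset (MvPolynomial (Fin (N + 1)) ℂ)}
    (h : 𝔭' ∈ (M.relIdeal ⊔ Ideal.span (S : Set (MvPolynomial (Fin (N + 1)) ℂ))).minimalPrimes) :
    ((M.dim + 1 - S.card : ℕ) : WithBot ℕ∞) ≤ ringKrullDim (MvPolynomial (Fin (N + 1)) ℂ ⧸ 𝔭') := by
  classical
  haveI := h.1.1
  haveI := M.isPrime_relIdeal
  haveI : IsDomain (MvPolynomial (Fin (N + 1)) ℂ ⧸ M.relIdeal) := Ideal.Quotient.isDomain _
  set mk := Ideal.Quotient.mk M.relIdeal with hmk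
  have h𝔊le : M.relIdeal ≤ 𝔭' := le_sup_left.trans h.1.2
  -- `𝔭'/𝔊` is a minimal prime of `(S̄)`
  have hmin : 𝔭'.map mk ∈ ((Ideal.span (S : Set (MvPolynomial (Fin (N + 1)) ℂ))).map mk).minimalPrimes := by
    rw [Ideal.minimalPrimes_map_of_surjective Ideal.Quotient.mk_surjective, Ideal.mk_ker, sup_comm]
    exact ⟨𝔭', h, rfl⟩
  rw [Ideal.map_span, ← Finset.coe_image] at hmin
  have hht : (𝔭'.map mk).height ≤ S.card :=
    (Ideal.height_le_card_of_mem_minimalPrimes_span_finset hmin).trans (by exact_mod_cast Finset.card_image_le)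
  haveI hprime : (𝔭'.map mk).IsPrime := hmin.1.1
  obtain ⟨e, he⟩ := ENat.ne_top_iff_exists.mp (ne_top_of_le_ne_top (ENat.coe_ne_top S.card) hht)
  have he' : e ≤ S.card := by rw [← he] at hht; exact_mod_cast hht
  have hformula := Literature.RingTheory.KrullDimension.ringKrullDim_quotient_add_eq_of_height_eq ℂ e
    (A := MvPolynomial (Fin (N + 1)) ℂ ⧸ M.relIdeal) (𝔭'.map mk) he.symm
  rw [M.ringKrullDim_quotient_relIdeal, RingEquiv.ringKrullDim (DoubleQuot.quotQuotEquivQuotOfLE h𝔊le)] at hformula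
  -- `dim (ℂ[X]/𝔭')` is a natural number `d` with `d + e = n + 1`
  have hne : ringKrullDim (MvPolynomial (Fin (N + 1)) ℂ ⧸ 𝔭') ≠ ⊥ := by
    intro hbot
    rw [hbot, WithBot.bot_add, ← WithBot.coe_natCast] at hformula
    exact WithBot.bot_ne_coe hformula
  obtain ⟨D', hD'⟩ := WithBot.ne_bot_iff_exists.mp hne
  rw [← hD'] at hformula ⊢
  have h1 : D' + (e : ℕ∞) = ((M.dim + 1 : ℕ) : ℕ∞) := by
    apply WithBot.coe_inj.mp
    rw [WithBot.coe_add, WithBot.coe_natCast, WithBot.coe_natCast]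
    exact hformula
  have hD'ne : D' ≠ ⊤ := by
    intro ht
    rw [ht, top_add] at h1
    exact absurd h1 (ENat.top_ne_coe _)
  obtain ⟨d, rfl⟩ := ENat.ne_top_iff_exists.mp hD'ne
  have h2 : d + e = M.dim + 1 := by exact_mod_cast h1
  have h3 : M.dim + 1 - S.card ≤ d := by omega
  rw [← WithBot.coe_natCast]
  exact WithBot.coe_le_coe.mpr (by exact_mod_cast h3)

/-! ### The generic sequence -/

/-- `Qs` avoids, below `𝔭`, the minimal primes of its predecessors over `𝔊`: each `Q_{l+1}` lies
in no minimal prime `𝔭' ⊆ 𝔭` of `𝔊 + (Q₁, …, Q_l)`. [cite: NesterenkoPhilippon2001, Ch. 11 Prop. 2.2 (proof)] -/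
def AvoidsG (𝔭 : Ideal (MvPolynomial (Fin (N + 1)) ℂ)) (Qs : List (MvPolynomial (Fin (N + 1)) ℂ)) : Prop :=
  ∀ (L₁ : List (MvPolynomial (Fin (N + 1)) ℂ)) (q : MvPolynomial (Fin (N + 1)) ℂ)
    (L₂ : List (MvPolynomial (Fin (N + 1)) ℂ)), Qs = L₁ ++ q :: L₂ →
    ∀ 𝔭' ∈ (M.relIdeal ⊔ Ideal.ofList L₁).minimalPrimes, 𝔭' ≤ 𝔭 → q ∉ 𝔭'

omit [CompleteSpace V] [FiniteDimensional ℂ V] in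
/-- `𝔊 + (Qs) = 𝔊 + (Qs.toFinset)`. [folklore] -/
theorem relIdeal_sup_ofList_eq [DecidableEq (MvPolynomial (Fin (N + 1)) ℂ)] (Qs : List (MvPolynomial (Fin (N + 1)) ℂ)) :
    M.relIdeal ⊔ Ideal.ofList Qs = M.relIdeal ⊔ Ideal.span (Qs.toFinset : Set (MvPolynomial (Fin (N + 1)) ℂ)) := by
  rw [Ideal.ofList, show ({r | r ∈ Qs} : Set (MvPolynomial (Fin (N + 1)) ℂ)) = ↑Qs.toFinset by ext; simp]

section Chain

variable {ι : Type*} (𝔭 : ι → Ideal (MvPolynomial (Fin (N + 1)) ℂ)) (h𝔭 : ∀ i, (𝔭 i).IsPrime)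
  (Fs : Finset (MvPolynomial (Fin (N + 1)) ℂ)) (r : ℕ) (hr : r ≤ M.dim + 1)
  (hDH : ∀ 𝔭' : Ideal (MvPolynomial (Fin (N + 1)) ℂ), 𝔭'.IsPrime → (∃ i, 𝔭' ≤ 𝔭 i) →
    M.relIdeal ≤ 𝔭' → (↑Fs : Set (MvPolynomial (Fin (N + 1)) ℂ)) ⊆ 𝔭' →
    ringKrullDim (MvPolynomial (Fin (N + 1)) ℂ ⧸ 𝔭') ≤ ((M.dim + 1 - r : ℕ) : WithBot ℕ∞))

include hr hDH in
/-- **The generic sequence**: `Q₁, …, Q_j ∈ span S` (`j ≤ r`) with each `Q_{l+1}` outside every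
minimal prime `𝔭' ⊆ 𝔭ᵢ` of `𝔊 + (Q₁, …, Q_l)`. [cite: NesterenkoPhilippon2001, Ch. 11 Prop. 2.2 (proof)] -/
theorem exists_list_avoids : ∀ j ≤ r, ∃ Qs : List (MvPolynomial (Fin (N + 1)) ℂ), Qs.length = j ∧
    (∀ Q ∈ Qs, Q ∈ Submodule.span ℂ (↑Fs : Set (MvPolynomial (Fin (N + 1)) ℂ))) ∧
    ∀ i, M.AvoidsG (𝔭 i) Qs := by
  classical
  intro j
  induction j with
  | zero =>
    intro _
    refine ⟨[], rfl, fun Q hQ => by simp at hQ, fun i L₁ q L₂ h => ?_⟩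
    exact absurd h (by simp)
  | succ j ih =>
    intro hj
    obtain ⟨Qs, hlen, hspan, hav⟩ := ih (by omega)
    set 𝓑 : Set (Ideal (MvPolynomial (Fin (N + 1)) ℂ)) :=
      {𝔭' | 𝔭' ∈ (M.relIdeal ⊔ Ideal.ofList Qs).minimalPrimes ∧ ∃ i, 𝔭' ≤ 𝔭 i} with h𝓑
    have h𝓑fin : 𝓑.Finite :=
      (Ideal.finite_minimalPrimes_of_isNoetherianRing _ (M.relIdeal ⊔ Ideal.ofList Qs)).subset fun _ h => h.1
    have hnot : ∀ 𝔭' ∈ 𝓑, ¬ ((Submodule.span ℂ (↑Fs : Set (MvPolynomial (Fin (N + 1)) ℂ)) :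
        Set (MvPolynomial (Fin (N + 1)) ℂ)) ⊆ 𝔭') := by
      rintro 𝔭' ⟨h𝔭'min, hi⟩ hsub
      have hF : (↑Fs : Set (MvPolynomial (Fin (N + 1)) ℂ)) ⊆ 𝔭' :=
        fun x hx => hsub (Submodule.subset_span hx)
      have h𝔊 : M.relIdeal ≤ 𝔭' := le_sup_left.trans h𝔭'min.1.2
      have h1 := hDH 𝔭' h𝔭'min.1.1 hi h𝔊 hF
      -- Krull: `dim ℂ[X]/𝔭' ≥ n + 1 - j`
      rw [M.relIdeal_sup_ofList_eq] at h𝔭'min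
      have h2 := M.ringKrullDim_quotient_ge_of_mem_minimalPrimes h𝔭'min
      have h3 : Qs.toFinset.card ≤ j := hlen ▸ List.toFinset_card_le Qs
      have h4 : ((M.dim + 1 - j : ℕ) : WithBot ℕ∞) ≤ ((M.dim + 1 - Qs.toFinset.card : ℕ) : WithBot ℕ∞) := by
        exact_mod_cast (show M.dim + 1 - j ≤ M.dim + 1 - Qs.toFinset.card by omega)
      have h5 : ((M.dim + 1 - j : ℕ) : WithBot ℕ∞) ≤ ((M.dim + 1 - r : ℕ) : WithBot ℕ∞) :=
        (h4.trans h2).trans h1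
      have h6 : M.dim + 1 - j ≤ M.dim + 1 - r := by exact_mod_cast h5
      omega
    obtain ⟨Q, hQ, hQavoid⟩ := GaGm.exists_mem_forall_notMem_of_not_subset _ h𝓑fin hnot
    refine ⟨Qs ++ [Q], by simp [hlen], fun Q' hQ' => ?_, fun i L₁ q L₂ hdec 𝔭' h𝔭' hle => ?_⟩
    · rw [List.mem_append, List.mem_singleton] at hQ'
      rcases hQ' with h | rfl
      · exact hspan Q' h
      · exact hQ
    · rcases GaGm.append_singleton_eq_append_cons hdec with ⟨rfl, rfl, rfl⟩ | ⟨L₂', hQs⟩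
      · exact hQavoid 𝔭' ⟨h𝔭', i, hle⟩
      · exact hav i L₁ q L₂' hQs 𝔭' h𝔭' hle

/-! ### Non-zero-divisors modulo the components, from the Cohen–Macaulay property of `ℂ[X]_𝔭 ⧸ 𝔊` -/

omit [CompleteSpace V] [FiniteDimensional ℂ V] in
/-- A surjection of a local ring onto a local ring maps the maximal ideal into the maximal ideal.
[folklore] -/
theorem map_maximalIdeal_le_of_surjective {A B : Type*} [CommRing A] [CommRing B] [IsLocalRing A]
    [IsLocalRing B] (π : A →+* B) (hπ : Function.Surjective π) {x : A} (hx : x ∈ maximalIdeal A) :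
    π x ∈ maximalIdeal B := by
  rw [IsLocalRing.mem_maximalIdeal, mem_nonunits_iff]
  intro hu
  obtain ⟨u, hu⟩ := hu
  obtain ⟨y, hy⟩ := hπ (↑u⁻¹ : B)
  have h1 : π (x * y - 1) = 0 := by rw [map_sub, map_mul, map_one, hy, ← hu, Units.mul_inv, sub_self]
  have hker : x * y - 1 ∈ maximalIdeal A := by
    have : x * y - 1 ∈ RingHom.ker π := h1
    exact (IsLocalRing.le_maximalIdeal (RingHom.ker_ne_top π)) this
  have hxy : x * y ∈ maximalIdeal A := Ideal.mul_mem_right _ _ hx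
  have : (1 : A) ∈ maximalIdeal A := by
    have := Ideal.sub_mem _ hxy hker
    rwa [sub_sub_cancel] at this
  exact (IsLocalRing.maximalIdeal.isMaximal A).ne_top ((Ideal.eq_top_iff_one _).mpr this)

omit [CompleteSpace V] [FiniteDimensional ℂ V] in
/-- Non-zero-divisors modulo components from the Cohen–Macaulay property of `R_𝔮 ⧸ 𝔊 R_𝔮`, for any
model `R_𝔮` of the localization at the prime `𝔮 ⊇ 𝔊` whose quotient by `𝔊` is a regular local
ring. [cite: NesterenkoPhilippon2001, Ch. 11 Prop. 2.2 (proof)] -/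
theorem isNZDMod_loc_ofList_of_isRegularLocalRing {𝔮 : Ideal (MvPolynomial (Fin (N + 1)) ℂ)} (h𝔮 : 𝔮.IsPrime)
    (Rp : Type*) [CommRing Rp] [Algebra (MvPolynomial (Fin (N + 1)) ℂ) Rp] [IsLocalization.AtPrime Rp 𝔮]
    (hreg : IsRegularLocalRing (Rp ⧸ M.relIdeal.map (algebraMap (MvPolynomial (Fin (N + 1)) ℂ) Rp)))
    {Qs : List (MvPolynomial (Fin (N + 1)) ℂ)} (hQ : ∀ q ∈ Qs, q ∈ 𝔮) (hav : M.AvoidsG 𝔮 Qs)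
    {L₁ : List (MvPolynomial (Fin (N + 1)) ℂ)} {q : MvPolynomial (Fin (N + 1)) ℂ}
    {L₂ : List (MvPolynomial (Fin (N + 1)) ℂ)} (hdec : Qs = L₁ ++ q :: L₂) :
    GaGm.IsNZDMod (GaGm.loc 𝔮 h𝔮 (M.relIdeal ⊔ Ideal.ofList L₁)) q := by
  haveI := h𝔮
  haveI : IsLocalRing Rp := IsLocalization.AtPrime.isLocalRing Rp 𝔮
  set alg := algebraMap (MvPolynomial (Fin (N + 1)) ℂ) Rp with halg
  set G' : Ideal Rp := M.relIdeal.map alg with hG'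
  haveI := hreg
  set π : Rp →+* Rp ⧸ G' := Ideal.Quotient.mk G' with hπdef
  have hπ : Function.Surjective π := Ideal.Quotient.mk_surjective
  set f' : MvPolynomial (Fin (N + 1)) ℂ →+* Rp ⧸ G' := π.comp alg with hf'
  -- `Rp ⧸ G'` is regular, hence Cohen–Macaulay
  obtain ⟨rs, hrs, hmem, hlen⟩ := exists_isRegular_length_eq_ringKrullDim (Rp ⧸ G')
  have hQm : ∀ x ∈ Qs.map f', x ∈ maximalIdeal (Rp ⧸ G') := by
    intro x hx
    obtain ⟨q', hq', rfl⟩ := List.mem_map.mp hx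
    exact map_maximalIdeal_le_of_surjective π hπ ((IsLocalization.AtPrime.to_map_mem_maximal_iff Rp 𝔮 q').mpr (hQ q' hq'))
  -- the kernel of `π` and the images of the ideals `𝔊 + (L)`
  have hkerπ : RingHom.ker π = G' := Ideal.mk_ker
  have hmapG : ∀ L : List (MvPolynomial (Fin (N + 1)) ℂ),
      (Ideal.ofList L).map f' = ((M.relIdeal ⊔ Ideal.ofList L).map alg).map π := by
    intro L
    rw [Ideal.map_sup, Ideal.map_sup, ← hG', (Ideal.map_eq_bot_iff_le_ker π).mpr (by rw [hkerπ]), bot_sup_eq,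
      Ideal.map_map]
  -- avoidance in `Rp ⧸ G'`
  have havoid : AvoidsMinimalPrimes (Qs.map f') := by
    intro M₁ x M₂ hdec' 𝔓 h𝔓 hx
    obtain ⟨K₁, K, rfl, hK₁, hK⟩ := List.map_eq_append_iff.mp hdec'
    obtain ⟨q₀, K₂, rfl, hq₀, hK₂⟩ := List.map_eq_cons_iff.mp hK
    rw [← hK₁, ← Ideal.map_ofList, hmapG, Ideal.minimalPrimes_map_of_surjective hπ, hkerπ] at h𝔓
    obtain ⟨𝔓₀, h𝔓₀, rfl⟩ := h𝔓
    have hG'le : G' ≤ (M.relIdeal ⊔ Ideal.ofList K₁).map alg := Ideal.map_mono le_sup_left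
    rw [sup_eq_left.mpr hG'le, IsLocalization.minimalPrimes_map 𝔮.primeCompl Rp] at h𝔓₀
    have h1 : 𝔓₀.under (MvPolynomial (Fin (N + 1)) ℂ) ∈ (M.relIdeal ⊔ Ideal.ofList K₁).minimalPrimes := h𝔓₀
    have hG'𝔓₀ : G' ≤ 𝔓₀ := hG'le.trans (Ideal.map_le_iff_le_comap.mpr h1.1.2)
    have h𝔓₀ne : 𝔓₀ ≠ ⊤ := by
      intro htop
      exact h1.1.1.ne_top (by rw [Ideal.under_def, htop, Ideal.comap_top])
    have hle : 𝔓₀.under (MvPolynomial (Fin (N + 1)) ℂ) ≤ 𝔮 := fun y hy => by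
      by_contra hy𝔮
      have hunit : IsUnit (alg y) := IsLocalization.map_units Rp (⟨y, hy𝔮⟩ : 𝔮.primeCompl)
      exact h𝔓₀ne (Ideal.eq_top_of_isUnit_mem _ hy hunit)
    refine hav K₁ q₀ K₂ rfl _ h1 hle ?_
    -- `q₀ ∈ 𝔓₀ ∩ R`
    rw [Ideal.under_def, Ideal.mem_comap]
    have hx' : alg q₀ ∈ Ideal.comap π (Ideal.map π 𝔓₀) := by
      rw [Ideal.mem_comap]
      have : π (alg q₀) = x := hq₀
      rw [this]; exact hx
    rw [Ideal.comap_map_of_surjective π hπ, ← RingHom.ker_eq_comap_bot, hkerπ, sup_eq_left.mpr hG'𝔓₀] at hx'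
    exact hx'
  have hreg' : IsRegular (Rp ⧸ G') (Qs.map f') :=
    isRegular_of_forall_notMem_minimalPrimes hrs hmem hlen hQm havoid
  -- regularity of `f' q` on `(Rp ⧸ G') ⧸ (L₁)`
  have hw := hreg'.toIsWeaklyRegular
  rw [hdec, List.map_append, List.map_cons, isWeaklyRegular_append_iff, isWeaklyRegular_cons_iff] at hw
  obtain ⟨-, hsm, -⟩ := hw
  intro g hg
  obtain ⟨P, hP, hPqg⟩ := hg
  set Nn : Submodule (Rp ⧸ G') (Rp ⧸ G') := Ideal.ofList (L₁.map f') • ⊤ with hNn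
  have hNeq : Nn = (((Ideal.ofList L₁).map f' : Ideal (Rp ⧸ G')) : Submodule (Rp ⧸ G') (Rp ⧸ G')) := by
    rw [hNn, smul_eq_mul, Ideal.mul_top, Ideal.map_ofList]
  have hx0 : (Submodule.Quotient.mk (f' (P * g)) : (Rp ⧸ G') ⧸ Nn) = 0 := by
    refine hsm.right_eq_zero_of_smul ?_
    rw [← Submodule.Quotient.mk_smul, smul_eq_mul, ← map_mul, Submodule.Quotient.mk_eq_zero, hNeq]
    have e : q * (P * g) = P * (q * g) := by ring
    rw [e, hmapG]
    exact Ideal.mem_map_of_mem π (Ideal.mem_map_of_mem alg hPqg)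
  rw [Submodule.Quotient.mk_eq_zero, hNeq] at hx0
  have hx1 : f' (P * g) ∈ (Ideal.ofList L₁).map f' := hx0
  rw [hmapG] at hx1
  -- lift to `Rp`
  have hx2 : alg (P * g) ∈ (M.relIdeal ⊔ Ideal.ofList L₁).map alg := by
    have : alg (P * g) ∈ Ideal.comap π (Ideal.map π ((M.relIdeal ⊔ Ideal.ofList L₁).map alg)) := by
      rw [Ideal.mem_comap]; exact hx1
    rw [Ideal.comap_map_of_surjective π hπ, ← RingHom.ker_eq_comap_bot, hkerπ,
      sup_eq_left.mpr (Ideal.map_mono le_sup_left : G' ≤ (M.relIdeal ⊔ Ideal.ofList L₁).map alg)] at this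
    exact this
  rw [halg, IsLocalization.algebraMap_mem_map_algebraMap_iff 𝔮.primeCompl] at hx2
  obtain ⟨m, hm, hmPg⟩ := hx2
  exact ⟨m * P, fun h => (h𝔮.mem_or_mem h).elim hm hP, by rwa [mul_assoc]⟩

/-- **Non-zero-divisors modulo components from the Cohen–Macaulay property of `ℂ[X]_𝔭 ⧸ 𝔊`.**
If `𝔭 ⊇ 𝔊` is a relevant homogeneous prime, `Q₁, …, Q_k ∈ 𝔭` and each `Q_{l+1}` avoids the
minimal primes `𝔭' ⊆ 𝔭` of `𝔊 + (Q₁, …, Q_l)`, then `Q_{l+1}` is a non-zero-divisor modulo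
`loc 𝔭 (𝔊 + (Q₁, …, Q_l))`. [cite: NesterenkoPhilippon2001, Ch. 11 Prop. 2.2 (proof)] -/
theorem isNZDMod_loc_ofList {𝔮 : Ideal (MvPolynomial (Fin (N + 1)) ℂ)} (h𝔮 : 𝔮.IsPrime)
    (hhom : 𝔮.IsHomogeneous (homogeneousSubmodule (Fin (N + 1)) ℂ)) (h𝔊 : M.relIdeal ≤ 𝔮) (hrel : M.IsRelevant 𝔮)
    {Qs : List (MvPolynomial (Fin (N + 1)) ℂ)} (hQ : ∀ q ∈ Qs, q ∈ 𝔮) (hav : M.AvoidsG 𝔮 Qs)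
    {L₁ : List (MvPolynomial (Fin (N + 1)) ℂ)} {q : MvPolynomial (Fin (N + 1)) ℂ}
    {L₂ : List (MvPolynomial (Fin (N + 1)) ℂ)} (hdec : Qs = L₁ ++ q :: L₂) :
    GaGm.IsNZDMod (GaGm.loc 𝔮 h𝔮 (M.relIdeal ⊔ Ideal.ofList L₁)) q := by
  haveI := h𝔮
  obtain ⟨-, -, -, hreg⟩ := M.relIdeal_map_eq_span_and_isRegularLocalRing hhom h𝔊 hrel
  exact M.isNZDMod_loc_ofList_of_isRegularLocalRing h𝔮 (Localization.AtPrime 𝔮) hreg hQ hav hdec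

/-! ### The chain and the lossy Bézout bound -/

include hr hDH in
/-- **The ideal of the generic complete intersection over `𝔊`, localised at the `𝔭ᵢ`, and its
lossy Bézout bound**: for relevant homogeneous primes `𝔭ᵢ ⊇ 𝔊` and `S` of degree `≤ δ` inside all
`𝔭ᵢ`, there is `𝔍` with `𝔍 ≤ loc 𝔭ᵢ (𝔊 + (S))` for all `i` and
`H_𝔍(t) ≤ 2^{(n+1) r} δ^r C_G (t+1)^{n+1-r}` for all `t`.
[cite: NesterenkoPhilippon2001, Ch. 11 Prop. 2.2 (lossy form)] -/
theorem exists_ideal_hilbC_le [Fintype ι] [Nonempty ι]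
    (hhom : ∀ i, (𝔭 i).IsHomogeneous (homogeneousSubmodule (Fin (N + 1)) ℂ))
    (h𝔊 : ∀ i, M.relIdeal ≤ 𝔭 i) (hrel : ∀ i, M.IsRelevant (𝔭 i)) {δ : ℕ}
    (hFdeg : (↑Fs : Set (MvPolynomial (Fin (N + 1)) ℂ)) ⊆ (ZeroEst.Fil (N := N) δ : Set (MvPolynomial (Fin (N + 1)) ℂ)))
    (hF𝔭 : ∀ i, (↑Fs : Set (MvPolynomial (Fin (N + 1)) ℂ)) ⊆ (𝔭 i : Set (MvPolynomial (Fin (N + 1)) ℂ))) :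
    ∃ 𝔍 : Ideal (MvPolynomial (Fin (N + 1)) ℂ),
      (∀ i, 𝔍 ≤ GaGm.loc (𝔭 i) (h𝔭 i) (M.relIdeal ⊔ Ideal.span (↑Fs : Set (MvPolynomial (Fin (N + 1)) ℂ)))) ∧
      ∀ t, ZeroEst.hilbC (𝔍.restrictScalars ℂ) t ≤
        2 ^ ((M.dim + 1) * r) * δ ^ r * M.hilbConst * (t + 1) ^ (M.dim + 1 - r) := by
  classical
  obtain ⟨Qs, hlen, hspan, hav⟩ := M.exists_list_avoids 𝔭 Fs r hr hDH r le_rfl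
  have hspanFil : Submodule.span ℂ (↑Fs : Set (MvPolynomial (Fin (N + 1)) ℂ)) ≤ ZeroEst.Fil (N := N) δ :=
    Submodule.span_le.mpr hFdeg
  have hspan𝔭 : ∀ i, Submodule.span ℂ (↑Fs : Set (MvPolynomial (Fin (N + 1)) ℂ)) ≤ (𝔭 i).restrictScalars ℂ :=
    fun i => Submodule.span_le.mpr (hF𝔭 i)
  have hspanI : Submodule.span ℂ (↑Fs : Set (MvPolynomial (Fin (N + 1)) ℂ)) ≤
      (Ideal.span (↑Fs : Set (MvPolynomial (Fin (N + 1)) ℂ))).restrictScalars ℂ :=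
    Submodule.span_le.mpr fun x hx => Ideal.subset_span hx
  have hofList : ∀ L : List (MvPolynomial (Fin (N + 1)) ℂ), (∀ Q ∈ L, Q ∈ Qs) →
      ∀ i, M.relIdeal ⊔ Ideal.ofList L ≤ 𝔭 i := fun L hL i => by
    refine sup_le (h𝔊 i) ?_
    rw [Ideal.ofList, Ideal.span_le]
    intro Q hQ
    exact hspan𝔭 i (hspan Q (hL Q hQ))
  -- the chain
  let 𝔍 : ℕ → Ideal (MvPolynomial (Fin (N + 1)) ℂ) := fun j =>
    Finset.univ.inf fun i => GaGm.loc (𝔭 i) (h𝔭 i) (M.relIdeal ⊔ Ideal.ofList (Qs.take j))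
  let Q : ℕ → MvPolynomial (Fin (N + 1)) ℂ := fun j => Qs.getD (j - 1) 0
  have hQmem : ∀ j < r, Q (j + 1) ∈ Qs := fun j hj => by
    simp only [Q, Nat.add_sub_cancel]
    rw [List.getD_eq_getElem _ _ (by omega)]
    exact List.getElem_mem _
  have hdec : ∀ j < r, Qs = Qs.take j ++ Q (j + 1) :: Qs.drop (j + 1) := fun j hj => by
    simp only [Q, Nat.add_sub_cancel]
    rw [List.getD_eq_getElem _ _ (by omega), ← List.drop_eq_getElem_cons (by omega), List.take_append_drop]
  -- `𝔍 0 = 𝔊`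
  have hloc𝔊 : ∀ i, GaGm.loc (𝔭 i) (h𝔭 i) M.relIdeal = M.relIdeal := fun i => by
    refine le_antisymm (fun g ⟨P, hP, hPg⟩ => ?_) (GaGm.le_loc (h𝔭 i) _)
    exact (M.isPrime_relIdeal.mem_or_mem hPg).resolve_left fun h => hP (h𝔊 i h)
  have h0 : 𝔍 0 = M.relIdeal := by
    show Finset.univ.inf (fun i => GaGm.loc (𝔭 i) (h𝔭 i) (M.relIdeal ⊔ Ideal.ofList (Qs.take 0))) = M.relIdeal
    simp only [List.take_zero, Ideal.ofList_nil, sup_bot_eq, hloc𝔊]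
    exact Finset.inf_const Finset.univ_nonempty _
  have hne : ∀ j < r, 𝔍 j ≠ ⊤ := fun j hj htop => by
    obtain ⟨i⟩ := ‹Nonempty ι›
    have h1 : 𝔍 j ≤ 𝔭 i := (Finset.inf_le (Finset.mem_univ i)).trans
      (GaGm.loc_le (h𝔭 i) (hofList _ (fun Q hQ => List.mem_of_mem_take hQ) i))
    exact (h𝔭 i).ne_top (top_le_iff.mp (htop ▸ h1))
  have hQB : ∀ j < r, Q (j + 1) ∈ ZeroEst.Fil (N := N) δ := fun j hj => hspanFil (hspan _ (hQmem j hj))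
  have hQnzd : ∀ j < r, GaGm.IsNZDMod (𝔍 j) (Q (j + 1)) := fun j hj =>
    GaGm.isNZDMod_finsetInf _ _ fun i _ =>
      M.isNZDMod_loc_ofList (h𝔭 i) (hhom i) (h𝔊 i) (hrel i) (fun q hq => hspan𝔭 i (hspan q hq)) (hav i) (hdec j hj)
  have hstep : ∀ j < r, 𝔍 j ⊔ Ideal.span {Q (j + 1)} ≤ 𝔍 (j + 1) := fun j hj => by
    have htake : Qs.take (j + 1) = Qs.take j ++ [Q (j + 1)] := by
      simp only [Q, Nat.add_sub_cancel]
      rw [List.getD_eq_getElem _ _ (by omega), List.take_succ_eq_append_getElem (by omega)]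
    refine Finset.le_inf fun i _ => sup_le ((Finset.inf_le (Finset.mem_univ i)).trans (GaGm.loc_mono (h𝔭 i) ?_)) ?_
    · rw [htake, Ideal.ofList_append]
      exact sup_le_sup_left le_sup_left _
    · rw [Ideal.span_singleton_le_iff_mem]
      refine GaGm.le_loc (h𝔭 i) _ ?_
      rw [htake, Ideal.ofList_append, Ideal.ofList_singleton]
      exact Ideal.mem_sup_right (Ideal.mem_sup_right (Ideal.mem_span_singleton_self _))
  have h0bd : ∀ t, ZeroEst.hilbC ((𝔍 0).restrictScalars ℂ) t ≤ M.hilbConst * (t + 1) ^ (M.dim + 1) := fun t => by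
    rw [h0]; exact M.hilbC_relIdeal_le t
  have hbound := ZeroEst.hilbC_chain_le 𝔍 Q r (M.dim + 1) M.hilbConst δ h0bd hne hQB hQnzd hstep r le_rfl hr
  refine ⟨𝔍 r, fun i => (Finset.inf_le (Finset.mem_univ i)).trans (GaGm.loc_mono (h𝔭 i) ?_), hbound⟩
  refine sup_le_sup_left ?_ _
  rw [List.take_of_length_le (by omega), Ideal.ofList, Ideal.span_le]
  intro q hq
  exact hspanI (hspan q hq)

end Chain

end AnalyticGroupModel

end Literature.NumberTheory.Transcendental
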